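import Literature.Probability.RandomPlanarGeometry.HullSubdomainPullback
import Literature.Probability.RandomPlanarGeometry.ConformalMapCaratheodoryProofs
import Mathlib.Analysis.SpecificLimits.Basic
import HarnessLib

/-!
# Crux `SAWDevelopingMap.ObservableToSLE` (stmt-CriticalPhenomena-10472), line
`floor-ratio-restriction-bootstrap`: the metric collar of a hull subdomain (helper for STUB 4b)

Landing target:
`Summits/CriticalPhenomena/SAWScalingLimit/Theorems/SAWDevelopingMapObservableToSLEHullApproxCollar.lean`
(`--supports stmt-CriticalPhenomena-10472`).

For a hull subdomain `D'` of a Dobrushin domain `D` with chordal uniformizer `φ : ℍ → D` and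
`r > 0`, the points `w ∈ ℍ` at distance `≥ r` from `F := closure (φ⁻¹ D')` are mapped by `φ`
uniformly far from `D'`: `infDist (φ w) D' > η` for some `η > 0` depending only on `(D, D', φ, r)`.
Proof by compactness and Carathéodory's theorem (Pommerenke (1992), Thm. 2.6, the tree's theorem
`JordanDomain.exists_continuousOn_extension_holds`): such `w` lie in a fixed closed ball (the
pulled-back hull is bounded, `ConformalEquiv.isBounded_pullbackHull`); if `w_k` were such points
with `infDist (φ w_k) D' → 0`, pick `z_k ∈ D'` with `dist (φ w_k) z_k → 0` and a limit point `w⋆`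
(`im w⋆ ≥ 0`) of the `w_k`; the Carathéodory extension gives `φ w_k → φ̂ w⋆` along the
subsequence, hence `z_k → φ̂ w⋆`, and the INVERSE boundary behaviour
(`JordanDomain.tendsto_cayleyFun_symm`) gives `φ⁻¹ z_k → w⋆`; but `φ⁻¹ z_k ∈ φ⁻¹ D' ⊆ F` is at
distance `≥ r` from `w_k`, a contradiction.

* `cayleyFun_ne_one` — `cayleyFun z ≠ 1` on the closed upper half-plane;
* `tendsto_symm_of_extension` — `φ⁻¹ z → w⋆` as `z → φ̂ w⋆` within `D`, for every `w⋆` with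
  `im w⋆ ≥ 0`;
* `stub_hullApproxDomain_collar` — the collar lemma (registered sub-goal of STUB 4b);
* `collar_of_far` — **the same, under the name consumed verbatim by STUB 4b (`stub_hullApproxDomain`)**.
-/

noncomputable section

open scoped Topology NNReal
open Filter Set MeasureTheory Metric Complex
open Literature.Probability.RandomPlanarGeometry
open UpperHalfPlane (upperHalfPlaneSet)

namespace Summit.CriticalPhenomena.SAWScalingLimit.Theorems.ObservableToSLE.FloorRatio

/-- `cayleyFun z = (z - i)/(z + i) ≠ 1` for `im z ≥ 0`. [folklore] -/
theorem cayleyFun_ne_one {z : ℂ} (hz : 0 ≤ z.im) : cayleyFun z ≠ 1 := by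
  rw [cayleyFun_apply, Ne, div_eq_one_iff_eq (add_I_ne_zero hz)]
  intro h
  have := congrArg Complex.im h
  simp only [sub_im, add_im, I_im] at this
  linarith

/-- **Inverse boundary behaviour of `φ : ℍ → D` at every point of the closed half-plane** (from a
Carathéodory extension `Ψ` of `φ ∘ C⁻¹`, Pommerenke (1992), Thm. 2.6): `φ⁻¹ z → w⋆` as
`z → Ψ (C w⋆)` within `D`, for `im w⋆ ≥ 0`. [folklore] -/
theorem tendsto_symm_of_extension {D : DobrushinDomain}
    (φ : ConformalEquiv upperHalfPlaneSet D.carrier) {Ψ : ℂ → ℂ}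
    (hΨc : ContinuousOn Ψ (closedBall 0 1)) (hΨeq : EqOn Ψ (cayley.symm.trans φ) (ball 0 1))
    (hinj : InjOn Ψ (closedBall 0 1)) {wstar : ℂ} (hwstar : 0 ≤ wstar.im) :
    Tendsto φ.symm (𝓝[D.carrier] (Ψ (cayleyFun wstar))) (𝓝 wstar) := by
  have hζ : cayleyFun wstar ∈ closedBall (0 : ℂ) 1 :=
    mem_closedBall_zero_iff.2 (norm_cayleyFun_le_one hwstar)
  have hc1 := JordanDomain.tendsto_cayleyFun_symm φ hΨc hΨeq hinj hζ
  have hc2 : ContinuousAt cayleyInvFun (cayleyFun wstar) :=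
    differentiableOn_cayleyInvFun.continuousOn.continuousAt
      (isOpen_ne.mem_nhds (cayleyFun_ne_one hwstar))
  have h := hc2.tendsto.comp hc1
  rw [cayleyInvFun_cayleyFun (add_I_ne_zero hwstar)] at h
  refine h.congr' ?_
  filter_upwards [self_mem_nhdsWithin] with z hz
  exact cayleyInvFun_cayleyFun (add_I_ne_zero (le_of_lt (φ.symm_mapsTo hz)))

/-- **The metric collar of a hull subdomain.** For a hull subdomain `D'` of `D`, a chordal
uniformizer `φ` and `r > 0` there is `η > 0` such that every `w ∈ ℍ` at distance `≥ r` from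
`closure (φ⁻¹ D')` has `infDist (φ w) D' > η` (compactness of the far set, Carathéodory's theorem
for `φ` and the inverse boundary behaviour of `φ⁻¹`; Pommerenke (1992), Thm. 2.6).
Registered sub-goal `stub_hullApproxDomain_collar` of STUB 4b (`stub_hullApproxDomain`).
[cite: PommerenkeBBCM1992, Thm. 2.6] -/
theorem stub_hullApproxDomain_collar :
    ∀ (D D' : DobrushinDomain) (φ : ConformalEquiv upperHalfPlaneSet D.carrier) (r : ℝ),
      D.IsHullSubdomain D' → D.IsChordalUniformizing φ → 0 < r →
      ∃ η : ℝ, 0 < η ∧ ∀ w ∈ upperHalfPlaneSet,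
        r ≤ infDist w (closure (φ.pullbackDomain D')) → η < infDist (φ w) D'.carrier := by
  intro D D' φ r hD' hφ hr
  by_contra hneg
  push Not at hneg
  set F : Set ℂ := closure (φ.pullbackDomain D') with hF
  -- a bad sequence `w k`, and points `z k ∈ D'` close to `φ (w k)`
  have hseq : ∀ k : ℕ, ∃ w ∈ upperHalfPlaneSet,
      r ≤ infDist w F ∧ infDist (φ w) D'.carrier ≤ 1 / ((k : ℝ) + 1) :=
    fun k ↦ hneg _ (by positivity)
  choose w hwH hwF hwD using hseq
  have hz : ∀ k : ℕ, ∃ z ∈ D'.carrier, dist (φ (w k)) z < 2 * (1 / ((k : ℝ) + 1)) := by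
    intro k
    refine (infDist_lt_iff D'.toJordanDomain.nonempty).1 ((hwD k).trans_lt ?_)
    have : (0 : ℝ) < 1 / ((k : ℝ) + 1) := by positivity
    linarith
  choose z hzD' hzd using hz
  -- `φ⁻¹ (z k) ∈ φ⁻¹ D' ⊆ F` is at distance `≥ r` from `w k`
  have hu : ∀ k, r ≤ dist (w k) (φ.symm (z k)) := fun k ↦
    (hwF k).trans (infDist_le_dist_of_mem (subset_closure
      (ConformalEquiv.symm_mapsTo_pullbackDomain hD'.carrier_subset (hzD' k))))
  -- the `w k` lie in a fixed closed ball (the pulled-back hull is bounded)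
  obtain ⟨R, hR⟩ := (ConformalEquiv.isBounded_pullbackHull hφ hD').subset_closedBall 0
  have hwR : ∀ k, w k ∈ closedBall (0 : ℂ) R := by
    intro k
    by_contra hk
    have hmem : w k ∈ φ.pullbackDomain D' := by
      rw [← ConformalEquiv.diff_pullbackHull]
      exact ⟨hwH k, fun h ↦ hk (hR h)⟩
    have h0 : infDist (w k) F = 0 := infDist_zero_of_mem (subset_closure hmem)
    linarith [hwF k]
  -- a limit point `wstar` of the `w k` in the closed half-plane
  set K : Set ℂ := closedBall (0 : ℂ) R ∩ closure upperHalfPlaneSet with hK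
  have hKc : IsCompact K := (isCompact_closedBall 0 R).inter_right isClosed_closure
  have hwK : ∀ k, w k ∈ K := fun k ↦ ⟨hwR k, subset_closure (hwH k)⟩
  obtain ⟨wstar, hwstarK, σ, hσ, hlim⟩ := hKc.tendsto_subseq hwK
  have hwstar : 0 ≤ wstar.im := mem_closure_upperHalfPlaneSet_iff.1 hwstarK.2
  -- Carathéodory data for `φ`
  obtain ⟨Ψ, hΨc, hΨeq, hbij, -⟩ :=
    JordanDomain.exists_continuousOn_extension_holds D.toJordanDomain (cayley.symm.trans φ)
  have hinj : InjOn Ψ (closedBall 0 1) := hbij.injOn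
  -- `φ (w (σ k)) → Ψ (C wstar)`, hence `z (σ k) → Ψ (C wstar)` within `D`
  have hlimH : Tendsto (w ∘ σ) atTop (𝓝[upperHalfPlaneSet] wstar) :=
    tendsto_nhdsWithin_iff.2 ⟨hlim, Eventually.of_forall fun k ↦ hwH (σ k)⟩
  have hφlim : Tendsto (fun k ↦ φ (w (σ k))) atTop (𝓝 (Ψ (cayleyFun wstar))) :=
    (JordanDomain.tendsto_nhdsWithin_of_extension φ hΨc hΨeq hwstar).comp hlimH
  have hε : Tendsto (fun k : ℕ ↦ 2 * (1 / ((k : ℝ) + 1))) atTop (𝓝 0) := by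
    have := (tendsto_one_div_add_atTop_nhds_zero_nat (𝕜 := ℝ)).const_mul (2 : ℝ)
    rwa [mul_zero] at this
  have hzlim : Tendsto (fun k ↦ z (σ k)) atTop (𝓝 (Ψ (cayleyFun wstar))) := by
    refine hφlim.congr_dist (squeeze_zero (fun k ↦ dist_nonneg) (fun k ↦ (hzd (σ k)).le) ?_)
    exact hε.comp hσ.tendsto_atTop
  have hzlimD : Tendsto (fun k ↦ z (σ k)) atTop (𝓝[D.carrier] (Ψ (cayleyFun wstar))) :=
    tendsto_nhdsWithin_iff.2 ⟨hzlim, Eventually.of_forall fun k ↦ hD'.carrier_subset (hzD' (σ k))⟩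
  -- `φ⁻¹ (z (σ k)) → wstar` (inverse boundary behaviour), contradicting `dist ≥ r`
  have hulim : Tendsto (fun k ↦ φ.symm (z (σ k))) atTop (𝓝 wstar) :=
    (tendsto_symm_of_extension φ hΨc hΨeq hinj hwstar).comp hzlimD
  have hdist : Tendsto (fun k ↦ dist (w (σ k)) (φ.symm (z (σ k)))) atTop (𝓝 (dist wstar wstar)) :=
    hlim.dist hulim
  rw [dist_self] at hdist
  have := ge_of_tendsto' hdist fun k ↦ hu (σ k)
  linarith

/-- **The metric collar of a hull subdomain**, under the name consumed verbatim by the worker of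
STUB 4b (`stub_hullApproxDomain`): `= stub_hullApproxDomain_collar`. [cite: PommerenkeBBCM1992, Thm. 2.6] -/
theorem collar_of_far :
    ∀ (D D' : DobrushinDomain) (φ : ConformalEquiv upperHalfPlaneSet D.carrier) (r : ℝ),
      D.IsHullSubdomain D' → D.IsChordalUniformizing φ → 0 < r →
      ∃ η : ℝ, 0 < η ∧ ∀ w ∈ upperHalfPlaneSet,
        r ≤ infDist w (closure (φ.pullbackDomain D')) → η < infDist (φ w) D'.carrier :=
  stub_hullApproxDomain_collar

end Summit.CriticalPhenomena.SAWScalingLimit.Theorems.ObservableToSLE.FloorRatio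

end
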